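import Mathlib
import Literature.Analysis.FunctionSpaces.SobolevDomainNormProofs
import Summits.NavierStokesRegularity.NavierStokesRegularity.Theorems.EulerZoomLiouvillePowerGaugeEulerLiouvilleAffineTimePast
import HarnessLib

/-!
# Crux `EulerZoomLiouville.PowerGaugeEulerLiouville` (stmt-NavierStokesRegularity-19832), stub `stub_nonSelfSimilarRest`:
# SEPARABLE pasts `u(τ, x) = θ(τ) U(x)` with NON-EVANESCENT modulation are trivial (the `E`-gauge)

Helper file (theorems only; `--supports stmt-NavierStokesRegularity-19832`; def-free).  Hand leafhand-ns-eulerzoomliouville-11 g0.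
Companion to the `A`-gauge strata `…AffineTimePast` / `…PolynomialTimePast` / `…SupercriticalModulationPast`: here the `E`-gauge
(`a^{ρ} E(a) ≤ c`, i.e. `∫∫_{Q_a} |∇u|² ≤ c a^{1−ρ}`) does the work, exactly as in the tree's steady-past theorem
`PastSteady.ae_eq_zero_of_gauge_of_pastSteady`, whose proof is followed step by step with a scalar modulation inserted.

THE STRATUM.  A member `(u, p, H, c)` (`ρ > 0`) of the form `u(τ, x) = θ(τ) U(x)` for a.e. `(τ, x) ∈ (−∞, T₁) × ℝ³` (`T₁ ≤ 0`,
`U : ℝ³ → ℝ³` ARBITRARY, `θ : ℝ → ℝ` measurable) whose modulation has POSITIVE LOWER CESÀRO MEAN SQUARE toward the past —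
`∫_{(−b², T₁)} θ² ≥ κ b²` for all large `b`, some `κ > 0` (e.g. `θ` periodic and not a.e. zero, `|θ| ≥ m > 0`, `θ → ℓ ≠ 0`, any
unbounded growth) — vanishes a.e. on the slab (`SeparablePast.ae_eq_zero_of_gauge_of_aeSeparablePast`, binder
`Birth.nonSelfSimilar_of_aeSeparablePast`).  `θ` constant is the steady-past stratum.  NOT covered (evanescent modulation,
`b^{-2}∫_{(−b²,T₁)} θ² → 0`): e.g. the `γ = 0` self-similar collapse `u = V(x)/(T − τ)` and `θ = |τ|^{−β}`, `β > 0`.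

PROOF.  (1) For a.e. `τ < T₁` the slice `H(τ)` is a weak derivative of `u(τ) = θ(τ) U` (slicing); at a good `τ₀` with `θ(τ₀) ≠ 0`
(exists: `θ` is not a.e. zero) `G := θ(τ₀)^{-1} H(τ₀)` is a weak derivative of `U`, and by uniqueness `H(τ) = θ(τ) G` a.e. for every
good `τ`.  (2) Tonelli on `(−b², T₁) × B_b` and the `E`-gauge: `(∫_{(−b²,T₁)} θ²) ∫_{B_b}|G|²_F ≤ c b^{1−ρ}`, so
`∫_{B_R}|G|²_F ≤ (c/κ) b^{−1−ρ} → 0`: `G = 0` a.e.  (3) Hence `U` is a.e. a constant `C` (zero weak gradient on `ℝ³`), the slice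
`u(τ₀) = θ(τ₀) C` is constant and the `A`-gauge kills it (`Shifted.growth_of_growth_le`, `NoDrift.eq_zero_of_const_of_lintegral_ball_le`):
`C = 0`.  (4) So `u = 0` a.e. on the past slab and `AePastSteady` concludes.

WHAT THIS IS NOT: not a proof of the stub or of the crux; nothing about Navier–Stokes. [folklore]
-/

noncomputable section

-- flat `Theorems/<Route><Decl>…` files of one crux share the namespace of the crux (tree convention)
set_option linter.dupNamespace false

open MeasureTheory Set Filter Topology Metric Function TopologicalSpace
open scoped RealInnerProductSpace NNReal ENNReal

namespace Summit.NavierStokesRegularity.NavierStokesRegularity.Theorems.PowerGaugeEulerLiouville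

open Literature.Analysis Literature.Analysis.FunctionSpaces Literature.Analysis.FluidPDE

namespace SeparablePast

/-- A weak derivative on the whole space survives an a.e. modification of the function. [folklore] -/
theorem hasWeakFDerivOn_congr_ae {f f' : EuclideanSpace ℝ (Fin 3) → EuclideanSpace ℝ (Fin 3)}
    {g : EuclideanSpace ℝ (Fin 3) → EuclideanSpace ℝ (Fin 3) →L[ℝ] EuclideanSpace ℝ (Fin 3)}
    (h : HasWeakFDerivOn (⊤ : Opens (EuclideanSpace ℝ (Fin 3))) volume f g) (hff' : f =ᵐ[volume] f') :
    HasWeakFDerivOn (⊤ : Opens (EuclideanSpace ℝ (Fin 3))) volume f' g where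
  locallyIntegrableOn := LocallyIntegrableOn.congr (ae_restrict_of_ae hff') h.locallyIntegrableOn
  locallyIntegrableOn_deriv := h.locallyIntegrableOn_deriv
  integral_fderiv_smul_eq φ v hφ := by
    rw [← h.integral_fderiv_smul_eq φ v hφ]
    refine integral_congr_ae ?_
    filter_upwards [ae_restrict_of_ae hff'] with x hx
    rw [hx]

/-- **SEPARABLE MEMBERS WITH NON-EVANESCENT MODULATION ARE TRIVIAL.**  Let `(u, p)` be a suitable weak Euler pair on `(−∞,0) × ℝ³`
with weak spatial gradient `H` and gauges `a^{2ρ} A(a) + a^{ρ} E(a) + a^{2ρ} D(a) ≤ c` (`ρ > 0`), and suppose `u(τ, x) = θ(τ) U(x)` for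
a.e. `(τ, x) ∈ (−∞, T₁) × ℝ³`, some `T₁ ≤ 0`, `U : ℝ³ → ℝ³` arbitrary and `θ : ℝ → ℝ` measurable with `∫_{(−b²,T₁)} θ² ≥ κ b²` for all
`b ≥ b₀`, some `κ > 0`.  Then `u = 0` a.e. on the slab. [folklore] -/
theorem ae_eq_zero_of_gauge_of_aeSeparablePast {ρ : ℝ} (hρ : 0 < ρ)
    {u : ℝ → EuclideanSpace ℝ (Fin 3) → EuclideanSpace ℝ (Fin 3)} {p : ℝ → EuclideanSpace ℝ (Fin 3) → ℝ}
    {H : ℝ → EuclideanSpace ℝ (Fin 3) → EuclideanSpace ℝ (Fin 3) →L[ℝ] EuclideanSpace ℝ (Fin 3)} {c : ℝ≥0}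
    (hsw : IsSuitableWeakSolutionOn (slab (EuclideanSpace ℝ (Fin 3)) (Iio 0) isOpen_Iio) 0 0 u p)
    (hH : HasWeakSpatialGradientOn (slab (EuclideanSpace ℝ (Fin 3)) (Iio 0) isOpen_Iio) u H)
    (hc : ∀ a : ℝ, 0 < a → ENNReal.ofReal (a ^ (2 * ρ)) * cknA a (0 : ℝ × EuclideanSpace ℝ (Fin 3)) u +
        ENNReal.ofReal (a ^ ρ) * cknE a (0 : ℝ × EuclideanSpace ℝ (Fin 3)) H +
        ENNReal.ofReal (a ^ (2 * ρ)) * cknD a (0 : ℝ × EuclideanSpace ℝ (Fin 3)) p ≤ (c : ℝ≥0∞))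
    {T₁ : ℝ} (hT₁ : T₁ ≤ 0) {θ : ℝ → ℝ} (hθm : Measurable θ) {U : EuclideanSpace ℝ (Fin 3) → EuclideanSpace ℝ (Fin 3)}
    (hθ : ∃ κ : ℝ, 0 < κ ∧ ∃ b₀ : ℝ, ∀ b : ℝ, b₀ ≤ b →
      ENNReal.ofReal (κ * b ^ 2) ≤ ∫⁻ t in Ioo (-(b ^ 2)) T₁, ‖θ t‖ₑ ^ 2)
    (hU : ∀ᵐ z ∂(volume.restrict (Iio T₁ ×ˢ (univ : Set (EuclideanSpace ℝ (Fin 3))))),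
      u z.1 z.2 = θ z.1 • U z.2) :
    uncurry u =ᵐ[volume.restrict (Iio (0 : ℝ) ×ˢ (univ : Set (EuclideanSpace ℝ (Fin 3))))] 0 := by
  obtain ⟨κ, hκ, b₀, hθ⟩ := hθ
  have hE : ∀ a : ℝ, 0 < a →
      ENNReal.ofReal (a ^ ρ) * cknE a (0 : ℝ × EuclideanSpace ℝ (Fin 3)) H ≤ (c : ℝ≥0∞) :=
    fun a ha => le_trans (le_trans le_add_self le_self_add) (hc a ha)
  have hA : ∀ a : ℝ, 0 < a → ENNReal.ofReal (a ^ (2 * ρ)) *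
      cknA a (0 : ℝ × EuclideanSpace ℝ (Fin 3)) u ≤ (c : ℝ≥0∞) :=
    fun a ha => le_trans (le_trans le_self_add le_self_add) (hc a ha)
  -- ## (1) good slices: a.e. `τ < T₁`, `H(τ)` is a weak derivative of `u(τ)`, and `u(τ) = θ(τ) U` a.e.
  set Good : Set ℝ := {τ | HasWeakFDerivOn (⊤ : Opens (EuclideanSpace ℝ (Fin 3))) volume (u τ) (H τ) ∧
    u τ =ᵐ[volume] fun x => θ τ • U x} with hGood
  have hgood : ∀ᵐ τ ∂(volume.restrict (Iio T₁)), τ ∈ Good := by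
    filter_upwards [FrameSteady.ae_hasWeakFDerivOn_slice_past hH hT₁,
      AffinePast.ae_ae_of_ae_slab (P := fun τ x => u τ x = θ τ • U x) hU] with τ hτ hτ'
    exact ⟨hτ, hτ'⟩
  have hGnull : volume (Goodᶜ ∩ Iio T₁) = 0 := by
    have h := hgood
    rw [ae_iff, Measure.restrict_apply' measurableSet_Iio] at h
    exact h
  -- every good slice of `u` is `θ(τ) U` with weak derivative `H(τ)`
  have hgoodW : ∀ τ, τ ∈ Good →
      HasWeakFDerivOn (⊤ : Opens (EuclideanSpace ℝ (Fin 3))) volume (fun x => θ τ • U x) (H τ) :=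
    fun τ hτ => hasWeakFDerivOn_congr_ae hτ.1 hτ.2
  -- ## a reference good slice `τ₀ < T₁` with `θ τ₀ ≠ 0` (`θ` is not a.e. zero on the past)
  obtain ⟨τ₀, hτ₀T, hτ₀G, hθ₀⟩ : ∃ τ, τ < T₁ ∧ τ ∈ Good ∧ θ τ ≠ 0 := by
    by_contra hne
    push Not at hne
    have hz : ∀ᵐ τ ∂(volume.restrict (Iio T₁)), θ τ = 0 := by
      filter_upwards [hgood, ae_restrict_mem measurableSet_Iio] with τ hτ hτT
      exact hne τ hτT hτ
    set b : ℝ := max b₀ 1 with hb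
    have hb1 : 1 ≤ b := le_max_right _ _
    have h0 : ∫⁻ t in Ioo (-(b ^ 2)) T₁, ‖θ t‖ₑ ^ 2 = 0 := by
      have h1 : ∀ᵐ t ∂(volume.restrict (Ioo (-(b ^ 2)) T₁)), θ t = 0 :=
        ae_restrict_of_ae_restrict_of_subset (fun t ht => ht.2) hz
      refine (lintegral_eq_zero_iff' (hθm.enorm.pow_const 2).aemeasurable).2 ?_
      filter_upwards [h1] with t ht
      simp [ht]
    have h2 := hθ b (le_max_left _ _)
    rw [h0, nonpos_iff_eq_zero, ENNReal.ofReal_eq_zero] at h2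
    have : 0 < κ * b ^ 2 := by positivity
    linarith
  have hτ₀0 : τ₀ < 0 := lt_of_lt_of_le hτ₀T hT₁
  -- ## the weak gradient `G := (θ τ₀)⁻¹ H(τ₀)` of `U`
  set G : EuclideanSpace ℝ (Fin 3) → EuclideanSpace ℝ (Fin 3) →L[ℝ] EuclideanSpace ℝ (Fin 3) :=
    (θ τ₀)⁻¹ • H τ₀ with hGdef
  have hGU : HasWeakFDerivOn (⊤ : Opens (EuclideanSpace ℝ (Fin 3))) volume U G := by
    have h := (hgoodW τ₀ hτ₀G).const_smul (θ τ₀)⁻¹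
    have e : ((θ τ₀)⁻¹ • fun x => θ τ₀ • U x) = U := by
      funext x; simp only [Pi.smul_apply, smul_smul, inv_mul_cancel₀ hθ₀, one_smul]
    rwa [e] at h
  -- every good slice before `T₁` carries the gradient `θ(τ) G` (uniqueness of weak derivatives)
  have hsame : ∀ τ, τ ∈ Good → H τ =ᵐ[volume] fun y => θ τ • G y := by
    intro τ hτG
    have h1 : HasWeakFDerivOn (⊤ : Opens (EuclideanSpace ℝ (Fin 3))) volume (fun x => θ τ • U x) (θ τ • G) :=
      hGU.const_smul (θ τ)
    have h2 := HasWeakFDerivOn.unique_holds (hgoodW τ hτG) h1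
    rw [Opens.coe_top, Measure.restrict_univ] at h2
    exact h2
  -- ## (2) the `E`-gauge: `κ b² ∫_{B_b} |G|²_F ≤ c b^{1−ρ}` once `b ≥ b₀`, `b > 0`
  set F : ℝ × EuclideanSpace ℝ (Fin 3) → ℝ≥0∞ := fun q => ENNReal.ofReal (frobeniusNormSq (H q.1 q.2)) with hF
  set g : EuclideanSpace ℝ (Fin 3) → ℝ≥0∞ := fun y => ENNReal.ofReal (frobeniusNormSq (G y)) with hg
  have hFm : ∀ b : ℝ, AEMeasurable F
      (volume.restrict (Ioo (-(b ^ 2)) T₁ ×ˢ ball (0 : EuclideanSpace ℝ (Fin 3)) b)) := by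
    intro b
    have hsub : Ioo (-(b ^ 2)) T₁ ×ˢ ball (0 : EuclideanSpace ℝ (Fin 3)) b ⊆
        ((slab (EuclideanSpace ℝ (Fin 3)) (Iio 0) isOpen_Iio : Opens _) :
          Set (ℝ × EuclideanSpace ℝ (Fin 3))) := by
      rw [coe_slab]
      exact prod_mono (fun t ht => lt_of_lt_of_le ht.2 hT₁) (subset_univ _)
    have hsm : AEStronglyMeasurable (uncurry H)
        (volume.restrict (Ioo (-(b ^ 2)) T₁ ×ˢ ball (0 : EuclideanSpace ℝ (Fin 3)) b)) :=
      hH.locallyIntegrableOn_grad.aestronglyMeasurable.mono_measure (Measure.restrict_mono hsub le_rfl)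
    exact ((ENNReal.continuous_ofReal.comp continuous_frobeniusNormSq').comp_aestronglyMeasurable
      hsm).aemeasurable
  have hGsmall : ∀ b : ℝ, 0 < b → b₀ ≤ b →
      ENNReal.ofReal (κ * b ^ 2) * ∫⁻ y in ball (0 : EuclideanSpace ℝ (Fin 3)) b, g y ≤
        ENNReal.ofReal ((c : ℝ) * b ^ (1 - ρ)) := by
    intro b hb hbb
    -- Tonelli on `(−b², T₁) × B_b`
    have hprod : (volume.restrict (Ioo (-(b ^ 2)) T₁ ×ˢ ball (0 : EuclideanSpace ℝ (Fin 3)) b) :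
        Measure (ℝ × EuclideanSpace ℝ (Fin 3))) =
        (volume.restrict (Ioo (-(b ^ 2)) T₁)).prod (volume.restrict (ball (0 : EuclideanSpace ℝ (Fin 3)) b)) := by
      rw [Measure.volume_eq_prod, Measure.prod_restrict]
    have hton : ∫⁻ q in Ioo (-(b ^ 2)) T₁ ×ˢ ball (0 : EuclideanSpace ℝ (Fin 3)) b, F q =
        ∫⁻ t in Ioo (-(b ^ 2)) T₁, ∫⁻ y in ball (0 : EuclideanSpace ℝ (Fin 3)) b, F (t, y) := by
      have hFm' := hFm b
      rw [hprod] at hFm' ⊢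
      exact lintegral_prod _ hFm'
    -- inner integrals on good slices
    have hinner : ∀ᵐ t ∂(volume.restrict (Ioo (-(b ^ 2)) T₁)),
        ∫⁻ y in ball (0 : EuclideanSpace ℝ (Fin 3)) b, F (t, y) =
          ‖θ t‖ₑ ^ 2 * ∫⁻ y in ball (0 : EuclideanSpace ℝ (Fin 3)) b, g y := by
      filter_upwards [ae_restrict_of_ae_restrict_of_subset (fun t ht => ht.2) hgood] with t ht
      rw [← lintegral_const_mul' _ _ (ENNReal.pow_ne_top enorm_ne_top)]
      refine lintegral_congr_ae (ae_restrict_of_ae ?_)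
      filter_upwards [hsame t ht] with y hy
      simp only [hF, hg]
      rw [hy, frobeniusNormSq_smul, ENNReal.ofReal_mul (sq_nonneg _), Real.enorm_eq_ofReal_abs,
        ← ENNReal.ofReal_pow (abs_nonneg _), sq_abs]
    have hsplit : ∫⁻ q in Ioo (-(b ^ 2)) T₁ ×ˢ ball (0 : EuclideanSpace ℝ (Fin 3)) b, F q =
        (∫⁻ t in Ioo (-(b ^ 2)) T₁, ‖θ t‖ₑ ^ 2) * ∫⁻ y in ball (0 : EuclideanSpace ℝ (Fin 3)) b, g y := by
      rw [hton, lintegral_congr_ae hinner, lintegral_mul_const _ (hθm.enorm.pow_const 2)]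
    calc ENNReal.ofReal (κ * b ^ 2) * ∫⁻ y in ball (0 : EuclideanSpace ℝ (Fin 3)) b, g y
        ≤ (∫⁻ t in Ioo (-(b ^ 2)) T₁, ‖θ t‖ₑ ^ 2) * ∫⁻ y in ball (0 : EuclideanSpace ℝ (Fin 3)) b, g y :=
          mul_le_mul' (hθ b hbb) le_rfl
      _ = ∫⁻ q in Ioo (-(b ^ 2)) T₁ ×ˢ ball (0 : EuclideanSpace ℝ (Fin 3)) b, F q := hsplit.symm
      _ ≤ ∫⁻ q in Ioo (-(b ^ 2)) 0 ×ˢ ball (0 : EuclideanSpace ℝ (Fin 3)) b, F q :=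
          lintegral_mono_set (prod_mono (Ioo_subset_Ioo le_rfl hT₁) Subset.rfl)
      _ ≤ ENNReal.ofReal ((c : ℝ) * b ^ (1 - ρ)) :=
          TimePeriodic.setLIntegral_window_le_of_gaugeE hb le_rfl le_rfl (hE b hb)
  -- ## hence `G = 0` a.e.
  have hGmeas : AEStronglyMeasurable G volume := by
    have h := hGU.locallyIntegrableOn_deriv.aestronglyMeasurable
    rwa [Opens.coe_top, Measure.restrict_univ] at h
  have hlim : Tendsto (fun b : ℝ => ENNReal.ofReal ((c : ℝ) / κ * b ^ (-(1 + ρ)))) atTop (𝓝 0) := by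
    rw [show (0 : ℝ≥0∞) = ENNReal.ofReal ((c : ℝ) / κ * 0) by simp]
    exact ENNReal.tendsto_ofReal ((tendsto_rpow_neg_atTop (by linarith)).const_mul _)
  have hball : ∀ r : ℝ, 0 < r → ∫⁻ y in ball (0 : EuclideanSpace ℝ (Fin 3)) r, g y = 0 := by
    intro r hr
    refine nonpos_iff_eq_zero.1 (ge_of_tendsto hlim ?_)
    filter_upwards [eventually_ge_atTop r, eventually_ge_atTop b₀, eventually_gt_atTop 0] with b hbr hbb hb0
    have h1 := hGsmall b hb0 hbb
    have hYpos : 0 < κ * b ^ 2 := by positivity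
    have hpos : ENNReal.ofReal (κ * b ^ 2) ≠ 0 := by rw [ENNReal.ofReal_ne_zero_iff]; exact hYpos
    have h2 : ∫⁻ y in ball (0 : EuclideanSpace ℝ (Fin 3)) b, g y ≤
        (ENNReal.ofReal (κ * b ^ 2))⁻¹ * ENNReal.ofReal ((c : ℝ) * b ^ (1 - ρ)) := by
      rw [← ENNReal.div_eq_inv_mul]
      exact ENNReal.le_div_iff_mul_le (Or.inl hpos) (Or.inl ENNReal.ofReal_ne_top) |>.2 (by rwa [mul_comm])
    refine (lintegral_mono_set (ball_subset_ball hbr)).trans (h2.trans (le_of_eq ?_))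
    rw [← ENNReal.ofReal_inv_of_pos hYpos, ← ENNReal.ofReal_mul (by positivity)]
    congr 1
    rw [show (-(1 + ρ) : ℝ) = (1 - ρ) - 2 by ring, Real.rpow_sub hb0 (1 - ρ) 2, Real.rpow_two]
    field_simp
  -- a linear map of `ℝ³` with vanishing Frobenius norm is zero (inlined as in `…PastSteady`, to stay inside this crux's cone;
  -- cf. the tree's `FrequencyRigidity.TwoEndedPinning.eq_zero_of_frobeniusNormSq_eq_zero`)
  have hfrob0 : ∀ L : EuclideanSpace ℝ (Fin 3) →L[ℝ] EuclideanSpace ℝ (Fin 3), frobeniusNormSq L = 0 → L = 0 := by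
    intro L h
    rw [frobeniusNormSq_eq_sum (stdOrthonormalBasis ℝ (EuclideanSpace ℝ (Fin 3)))] at h
    have h0 : ∀ i, L (stdOrthonormalBasis ℝ (EuclideanSpace ℝ (Fin 3)) i) = 0 := by
      intro i
      have := (Finset.sum_eq_zero_iff_of_nonneg (fun j _ => sq_nonneg _)).1 h i (Finset.mem_univ _)
      exact norm_eq_zero.1 ((pow_eq_zero_iff two_ne_zero).1 this)
    ext1 x
    rw [← (stdOrthonormalBasis ℝ (EuclideanSpace ℝ (Fin 3))).sum_repr x, map_sum]
    simp [h0]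
  have hG0 : G =ᵐ[volume] 0 := by
    have hballae : ∀ n : ℕ, ∀ᵐ y ∂volume, y ∈ ball (0 : EuclideanSpace ℝ (Fin 3)) ((n : ℝ) + 1) → G y = 0 := by
      intro n
      have hmeas : AEMeasurable g (volume.restrict (ball (0 : EuclideanSpace ℝ (Fin 3)) ((n : ℝ) + 1))) :=
        ((ENNReal.continuous_ofReal.comp continuous_frobeniusNormSq').comp_aestronglyMeasurable
          hGmeas.restrict).aemeasurable
      have h := (lintegral_eq_zero_iff' hmeas).1 (hball _ (by positivity))
      rw [Filter.EventuallyEq, ae_restrict_iff' measurableSet_ball] at h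
      filter_upwards [h] with y hy hyb
      have h1 := hy hyb
      simp only [hg, Pi.zero_apply, ENNReal.ofReal_eq_zero] at h1
      exact hfrob0 _ (le_antisymm h1 (frobeniusNormSq_nonneg _))
    filter_upwards [ae_all_iff.2 hballae] with y hy
    obtain ⟨n, hn⟩ := exists_nat_gt ‖y‖
    exact hy n (by rw [mem_ball_zero_iff]; linarith)
  -- ## (3) `U` has the zero weak derivative, is a.e. a constant `C`, and `θ(τ₀) C = 0`
  have hW0 : HasWeakFDerivOn (⊤ : Opens (EuclideanSpace ℝ (Fin 3))) volume U 0 :=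
    { locallyIntegrableOn := hGU.locallyIntegrableOn
      locallyIntegrableOn_deriv :=
        (locallyIntegrable_const (0 : EuclideanSpace ℝ (Fin 3) →L[ℝ] EuclideanSpace ℝ (Fin 3))
          ).locallyIntegrableOn _
      integral_fderiv_smul_eq := fun φ w hφ => by
        rw [hGU.integral_fderiv_smul_eq φ w hφ]
        congr 1
        refine integral_congr_ae ?_
        filter_upwards [ae_restrict_of_ae hG0] with y hy
        rw [hy] }
  obtain ⟨C, hC⟩ := ae_eq_const_of_hasWeakFDerivOn_zero hW0
  -- the slice `u τ₀` is a.e. the constant `θ τ₀ • C`; the `A`-gauge kills it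
  have hslice₀ : u τ₀ =ᵐ[volume] fun _ => θ τ₀ • C := by
    filter_upwards [hτ₀G.2, hC] with x hx hx'
    rw [hx, hx']
  have hb0 : θ τ₀ • C = 0 := by
    have hgrow : ∀ L : ℝ, Real.sqrt (-τ₀) + 1 ≤ L →
        ∫⁻ x in ball (0 : EuclideanSpace ℝ (Fin 3)) L, ‖(fun _ : EuclideanSpace ℝ (Fin 3) => θ τ₀ • C) x‖ₑ ^ 2 ≤
          (c : ℝ≥0∞) * ENNReal.ofReal (L ^ (1 - 2 * ρ)) := by
      intro L hL
      have hs0 : 0 ≤ Real.sqrt (-τ₀) := Real.sqrt_nonneg _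
      have hL0 : 0 < L := by linarith
      have hτL : τ₀ ∈ Ioo (-(L ^ 2)) 0 := by
        refine ⟨?_, hτ₀0⟩
        have h1 : Real.sqrt (-τ₀) ^ 2 = -τ₀ := Real.sq_sqrt (by linarith)
        have h3 : Real.sqrt (-τ₀) ^ 2 < L ^ 2 := pow_lt_pow_left₀ (by linarith) hs0 two_ne_zero
        linarith
      have h := Backward.lintegral_ball_le_of_gaugeA hL0 (hA L hL0) hτL
      have h' : ∫⁻ x in ball (0 : EuclideanSpace ℝ (Fin 3)) L, ‖(fun _ : EuclideanSpace ℝ (Fin 3) => θ τ₀ • C) x‖ₑ ^ 2 =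
          ∫⁻ x in ball (0 : EuclideanSpace ℝ (Fin 3)) L, ‖u τ₀ x‖ₑ ^ 2 := by
        refine lintegral_congr_ae (ae_restrict_of_ae ?_)
        filter_upwards [hslice₀] with x hx
        rw [hx]
      rw [h', ← ENNReal.ofReal_coe_nnreal, ← ENNReal.ofReal_mul c.coe_nonneg]
      exact h
    obtain ⟨C', hC', hCgrow⟩ := Shifted.growth_of_growth_le (V := fun _ : EuclideanSpace ℝ (Fin 3) => θ τ₀ • C)
      continuous_const (by linarith : 1 - 2 * ρ ≤ 3)
      (by linarith [Real.sqrt_nonneg (-τ₀)] : 1 ≤ Real.sqrt (-τ₀) + 1) ENNReal.coe_ne_top hgrow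
    exact NoDrift.eq_zero_of_const_of_lintegral_ball_le hC' (by linarith) hCgrow
  have hC0 : C = 0 := by
    rcases smul_eq_zero.1 hb0 with h | h
    · exact absurd h hθ₀
    · exact h
  -- ## (4) `u = 0` a.e. on the past slab
  have hU' : ∀ᵐ z ∂(volume.restrict (Iio T₁ ×ˢ (univ : Set (EuclideanSpace ℝ (Fin 3))))),
      u z.1 z.2 = (fun _ : EuclideanSpace ℝ (Fin 3) => (0 : EuclideanSpace ℝ (Fin 3))) z.2 := by
    have hCae : ∀ᵐ x ∂(volume : Measure (EuclideanSpace ℝ (Fin 3))), U x = 0 := by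
      filter_upwards [hC] with x hx; rw [hx, hC0]
    filter_upwards [hU, AffinePast.ae_slab_of_ae (T₁ := T₁) hCae] with z hz hz0
    rw [hz, hz0, smul_zero]
  exact AePastSteady.ae_eq_zero_of_gauge_of_aePastSteady hρ hsw hH hc hT₁
    (U := fun _ : EuclideanSpace ℝ (Fin 3) => (0 : EuclideanSpace ℝ (Fin 3))) hU'

end SeparablePast

/-! ## Binder language (`Birth.InClass`) -/

/-- **Binder language: SEPARABLE PAST WITH NON-EVANESCENT MODULATION ⇒ TRIVIAL** — `u(τ, x) = θ(τ) U(x)` for a.e.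
`(τ, x) ∈ (−∞,T₁) × ℝ³`, some `T₁ ≤ 0`, `U : ℝ³ → ℝ³` arbitrary, `θ : ℝ → ℝ` measurable with `∫_{(−b²,T₁)} θ² ≥ κ b²` for all large
`b`, some `κ > 0` (periodic non-null, bounded below in modulus, convergent to a non-zero limit, or growing modulations) ⇒ `u = 0` a.e.,
every `ρ > 0` (`SeparablePast.ae_eq_zero_of_gauge_of_aeSeparablePast`). [folklore] -/
theorem Birth.nonSelfSimilar_of_aeSeparablePast :
    ∀ ρ : ℝ, 0 < ρ →
      ∀ (u : ℝ → EuclideanSpace ℝ (Fin 3) → EuclideanSpace ℝ (Fin 3)) (p : ℝ → EuclideanSpace ℝ (Fin 3) → ℝ)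
        (H : ℝ → EuclideanSpace ℝ (Fin 3) → EuclideanSpace ℝ (Fin 3) →L[ℝ] EuclideanSpace ℝ (Fin 3)) (c : ℝ≥0),
        Birth.InClass ρ u p H c →
          (∃ T₁ : ℝ, T₁ ≤ 0 ∧ ∃ θ : ℝ → ℝ, ∃ U : EuclideanSpace ℝ (Fin 3) → EuclideanSpace ℝ (Fin 3),
              Measurable θ ∧
              (∃ κ : ℝ, 0 < κ ∧ ∃ b₀ : ℝ, ∀ b : ℝ, b₀ ≤ b →
                ENNReal.ofReal (κ * b ^ 2) ≤ ∫⁻ t in Ioo (-(b ^ 2)) T₁, ‖θ t‖ₑ ^ 2) ∧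
              ∀ᵐ z ∂(volume.restrict (Iio T₁ ×ˢ (univ : Set (EuclideanSpace ℝ (Fin 3))))),
                u z.1 z.2 = θ z.1 • U z.2) →
          uncurry u =ᵐ[volume.restrict (Iio (0 : ℝ) ×ˢ (univ : Set (EuclideanSpace ℝ (Fin 3))))] 0 := by
  intro ρ hρ u p H c hcl h
  obtain ⟨T₁, hT₁, θ, U, hθm, hθ, hU⟩ := h
  exact SeparablePast.ae_eq_zero_of_gauge_of_aeSeparablePast hρ hcl.1 hcl.2.1 hcl.2.2 hT₁ hθm hθ hU

end Summit.NavierStokesRegularity.NavierStokesRegularity.Theorems.PowerGaugeEulerLiouville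

end
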